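import Summits.AnomalousDissipation.AnomalousDissipation.Theses.DutyCycle
import Summits.AnomalousDissipation.AnomalousDissipation.Theorems.DutyCycleDensityFromSyndeticPhases
import Literature.Analysis.FluidPDE.LerayHopfUniformEnergy
import Literature.Analysis.FluidPDE.NSLerayHopf
import HarnessLib

/-! # BC5 RUNG for crux `DutyCycle.ReturnsHaveDensity` (item stmt-AnomalousDissipation-27340) — decomp-ad lens-3 g58

LANDABLE FORM (intended tree path `Summits/AnomalousDissipation/AnomalousDissipation/Theorems/DutyCycleReturnsHaveDensityRung.lean`,
namespace `Summit.AnomalousDissipation.AnomalousDissipation.Theorems.DutyCycle`; a prover lands it with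
`ledger propose --kind proof --target <that path> --supports stmt-AnomalousDissipation-27340` — it proves the two registered
stubs BY NAME + SIGNATURE and the BC5 rung; planners do not propose into Theorems/).

`returnsHaveDensity_rung : SyndeticSlimLoudReturns → DutyCycle.DenseSlimLoudReturns` — the crux Rβ1 (`L → D`,
FREQUENCY) RESTRICTED TO SYNDETIC FAMILIES, now a THEOREM (0 sorry): the two theorem-grade stubs of the registered
BC3 line «syndetic returns + loud-phase persistence» (skeleton `ReturnsHaveDensity_birth(_paste).lean`, stubs
`stub_loudPhasePersistence`, `stub_densityFromSyndeticPhases`) are PROVED here verbatim (`loudPhasePersistence`,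
`densityFromSyndeticPhases`); the line's only open stub is `stub_syndeticUpgrade : LateSlimLoudReturns →
SyndeticSlimLoudReturns` (IDEA-NEEDED, sufficient-only).

Why the rung lies outside S's known regime and exercises the lever: it converts a pure RETURN-TIME STATISTIC
(ν-free bounded gaps between slim-loud restart-good instants, no measure, no mean) into a ν-free DUTY CYCLE
`τ/(2(G+τ))` of the enlarged slim-loud box `(2B⁺ + 4‖f‖₂², β/2)` — the currency D of the child route — using only
the Leray–Hopf energy inequality from a restart and the time-sliced weak formulation tested with the steady force;
no statement about `limsup ν⟨‖∇u‖²⟩` (S) is known for syndetic families, and the persistence time `τ` is uniform in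
`ν ≤ νmax` (the route's lever: frequency × persistence = density, uniformly in viscosity).

* §1 `densityFromSyndeticPhases` — pure real analysis (greedy disjoint phases, null bad set); it lives in the companion file
  `DutyCycleDensityFromSyndeticPhases.lean` (part 1 of 2 — the split only respects the ≤ 400-line rule).
* §2 `energy_window`, `loud_window`, `loudPhasePersistence` — restart energy inequality + Young with `ε = 1/(2τ)`
  (no Grönwall); weak form tested with `f` (`Torus.IsLerayHopfOn.integral_inner_eq_add_setIntegral`).
* §3 the rung, with the ∃-statement «SYNDETIC SLIM-LOUD RETURNS» (`SyndeticSlimLoudReturns` of the registered BC3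
  skeleton, verbatim) INLINED as its antecedent (kernel lane; no `def … : Prop` in a Theorems proof file).
Tree facts used BY NAME: `Torus.IsLerayHopfOn.integral_inner_eq_add_setIntegral` [Temam1984, Ch. III Lemma 1.1],
`Torus.IsGlobalLerayHopf.ae_isGlobalLerayHopf_translate` [RobinsonRodrigoSadowski2016, Def. 4.9], `integral_inner_le_young`,
`IsGlobalLerayHopf.memLp_two`, `…integrableOn_integral_norm_sq`, `abs_integral_inner_convect_self_le`,
`aestronglyMeasurable_stLift_const`, `lintegral_enorm_sq_const_lt_top`. -/

noncomputable section

-- `Summit.<Summit>.<Problem>` is the tree's mandated summit-side namespace (CONVENTIONS §2); for this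
-- single-conjunct summit the two segments coincide, so the duplicate is deliberate.
set_option linter.dupNamespace false

open MeasureTheory Set Filter
open scoped RealInnerProductSpace
open Literature.Analysis Literature.Analysis.FluidPDE Literature.Analysis.FluidPDE.Torus

namespace Summit.AnomalousDissipation.AnomalousDissipation.Theorems.DutyCycle

/-! ### §2 Loud-phase persistence -/


/-- **Energy on a short window after a restart** (no Grönwall): if `w` is a global Leray–Hopf solution with
steady smooth force `f` from a datum `a` with `∫‖a‖² ≤ B`, then `∫‖w(r)‖² ≤ 2B + 4τ²‖f‖₂²` for `0 ≤ r ≤ τ`. -/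
theorem energy_window {f : UnitAddTorus (Fin 3) → EuclideanSpace ℝ (Fin 3)}
    (hf : FunctionSpaces.Torus.IsSmooth f) {ν : ℝ} (hν : 0 < ν)
    {a : UnitAddTorus (Fin 3) → EuclideanSpace ℝ (Fin 3)} {w : ℝ → UnitAddTorus (Fin 3) → EuclideanSpace ℝ (Fin 3)}
    (hw : IsGlobalLerayHopf ν (fun _ => f) a w) {B B' τ : ℝ} (hτ0 : 0 < τ)
    (hB : ∫ x, ‖a x‖ ^ 2 ≤ B) (hB' : 2 * B + 4 * τ ^ 2 * ∫ x, ‖f x‖ ^ 2 ≤ B')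
    {r : ℝ} (hr0 : 0 ≤ r) (hrτ : r ≤ τ) :
    ∫ x, ‖w r x‖ ^ 2 ≤ B' := by
  have hEf0 : 0 ≤ ∫ x, ‖f x‖ ^ 2 := integral_nonneg fun x => sq_nonneg _
  have hy0 : ∀ ρ, 0 ≤ ∫ x, ‖w ρ x‖ ^ 2 := fun ρ => integral_nonneg fun x => sq_nonneg _
  have hfL2 : MemLp f 2 volume := hf.memLp 2
  -- Young with parameter `ε = (2τ)⁻¹`
  have hY : ∀ ρ, 0 ≤ ρ → ∫ x, ⟪f x, w ρ x⟫ ≤ τ * (∫ x, ‖f x‖ ^ 2) + (4 * τ)⁻¹ * ∫ x, ‖w ρ x‖ ^ 2 := by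
    intro ρ hρ
    have h := integral_inner_le_young (ν := (2 * τ)⁻¹) (by positivity) hfL2 (hw.memLp_two hρ)
    have e1 : (∫ x, ‖f x‖ ^ 2) / (2 * (2 * τ)⁻¹) = τ * ∫ x, ‖f x‖ ^ 2 := by
      field_simp
    have e2 : (2 * τ)⁻¹ / 2 = (4 * τ)⁻¹ := by
      field_simp
      ring
    rw [e1, e2] at h
    exact h
  -- the energy is integrable in time on `(0, τ]`
  have hyi : IntegrableOn (fun ρ => ∫ x, ‖w ρ x‖ ^ 2) (Ioc 0 τ) := hw.integrableOn_integral_norm_sq hτ0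
  obtain ⟨I, hI⟩ : ∃ I : ℝ, I = ∫ ρ in Ioc 0 τ, ∫ x, ‖w ρ x‖ ^ 2 := ⟨_, rfl⟩
  have hI0 : 0 ≤ I := hI ▸ setIntegral_nonneg measurableSet_Ioc fun ρ _ => hy0 ρ
  -- pointwise-in-time bound from the energy inequality from `0`
  have hpt : ∀ ρ, 0 ≤ ρ → ρ ≤ τ →
      ∫ x, ‖w ρ x‖ ^ 2 ≤ B + 2 * τ ^ 2 * (∫ x, ‖f x‖ ^ 2) + (2 * τ)⁻¹ * I := by
    intro ρ hρ0 hρτ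
    have hE := (hw (τ + 1) (by linarith)).energy_ineq_zero ρ ⟨hρ0, by linarith⟩
    have hdiss : 0 ≤ ν * (∫⁻ σ in Ioo 0 ρ, FunctionSpaces.Torus.eGradNormSq (w σ)).toReal :=
      mul_nonneg hν.le ENNReal.toReal_nonneg
    have hka : FunctionSpaces.Torus.kineticEnergy a = 2⁻¹ * ∫ x, ‖a x‖ ^ 2 := rfl
    have hkw : FunctionSpaces.Torus.kineticEnergy (w ρ) = 2⁻¹ * ∫ x, ‖w ρ x‖ ^ 2 := rfl
    have hforce : ∫ σ in (0:ℝ)..ρ, ∫ x, ⟪f x, w σ x⟫ ≤ τ ^ 2 * (∫ x, ‖f x‖ ^ 2) + (4 * τ)⁻¹ * I := by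
      rw [intervalIntegral.integral_of_le hρ0]
      by_cases hint : IntegrableOn (fun σ => ∫ x, ⟪f x, w σ x⟫) (Ioc 0 ρ)
      · have hyiρ : IntegrableOn (fun σ => ∫ x, ‖w σ x‖ ^ 2) (Ioc 0 ρ) :=
          hyi.mono_set (Ioc_subset_Ioc_right hρτ)
        haveI : IsFiniteMeasure (volume.restrict (Ioc (0:ℝ) ρ)) :=
          ⟨by rw [Measure.restrict_apply_univ]; exact measure_Ioc_lt_top⟩
        have h1 : ∫ σ in Ioc 0 ρ, ∫ x, ⟪f x, w σ x⟫ ≤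
            ∫ σ in Ioc 0 ρ, (τ * (∫ x, ‖f x‖ ^ 2) + (4 * τ)⁻¹ * ∫ x, ‖w σ x‖ ^ 2) := by
          refine integral_mono_ae hint ((integrable_const _).add (hyiρ.const_mul _)) ?_
          filter_upwards [ae_restrict_mem measurableSet_Ioc] with σ hσ
          exact hY σ hσ.1.le
        have h2 : ∫ σ in Ioc 0 ρ, (τ * (∫ x, ‖f x‖ ^ 2) + (4 * τ)⁻¹ * ∫ x, ‖w σ x‖ ^ 2) =
            τ * (∫ x, ‖f x‖ ^ 2) * ρ + (4 * τ)⁻¹ * ∫ σ in Ioc 0 ρ, ∫ x, ‖w σ x‖ ^ 2 := by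
          rw [integral_add (integrable_const _) (hyiρ.const_mul _), integral_const_mul ((4 * τ)⁻¹),
            setIntegral_const, Real.volume_real_Ioc_of_le hρ0, smul_eq_mul]
          ring
        have h3 : ∫ σ in Ioc 0 ρ, ∫ x, ‖w σ x‖ ^ 2 ≤ I := by
          rw [hI]
          exact setIntegral_mono_set hyi (Eventually.of_forall fun σ => hy0 σ)
            (Ioc_subset_Ioc_right hρτ).eventuallyLE
        have h4 : τ * (∫ x, ‖f x‖ ^ 2) * ρ ≤ τ ^ 2 * ∫ x, ‖f x‖ ^ 2 := by
          have : τ * ρ ≤ τ ^ 2 := by nlinarith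
          nlinarith
        have h5 : (4 * τ)⁻¹ * ∫ σ in Ioc 0 ρ, ∫ x, ‖w σ x‖ ^ 2 ≤ (4 * τ)⁻¹ * I :=
          mul_le_mul_of_nonneg_left h3 (by positivity)
        linarith
      · rw [integral_undef hint]
        have h7 : 0 ≤ (4 * τ)⁻¹ * I := mul_nonneg (by positivity) hI0
        have h8 : 0 ≤ τ ^ 2 * ∫ x, ‖f x‖ ^ 2 := mul_nonneg (sq_nonneg τ) hEf0
        linarith
    rw [hkw, hka] at hE
    have e3 : (2:ℝ) * ((4 * τ)⁻¹ * I) = (2 * τ)⁻¹ * I := by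
      field_simp
      ring
    linarith
  -- integrate the pointwise bound over `(0, τ]`
  have hIle : I ≤ τ * (B + 2 * τ ^ 2 * (∫ x, ‖f x‖ ^ 2) + (2 * τ)⁻¹ * I) := by
    haveI : IsFiniteMeasure (volume.restrict (Ioc (0:ℝ) τ)) :=
      ⟨by rw [Measure.restrict_apply_univ]; exact measure_Ioc_lt_top⟩
    have h1 : ∫ ρ in Ioc 0 τ, ∫ x, ‖w ρ x‖ ^ 2 ≤
        ∫ ρ in Ioc 0 τ, (B + 2 * τ ^ 2 * (∫ x, ‖f x‖ ^ 2) + (2 * τ)⁻¹ * I) := by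
      refine integral_mono_ae hyi (integrable_const _) ?_
      filter_upwards [ae_restrict_mem measurableSet_Ioc] with ρ hρ
      exact hpt ρ hρ.1.le hρ.2
    rw [← hI, setIntegral_const, Real.volume_real_Ioc_of_le hτ0.le, smul_eq_mul, sub_zero] at h1
    exact h1
  have e4 : τ * ((2 * τ)⁻¹ * I) = I / 2 := by
    field_simp
  have hIb : I ≤ 2 * τ * B + 4 * τ ^ 3 * ∫ x, ‖f x‖ ^ 2 := by nlinarith
  have h6 : (2 * τ)⁻¹ * I ≤ (2 * τ)⁻¹ * (2 * τ * B + 4 * τ ^ 3 * ∫ x, ‖f x‖ ^ 2) :=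
    mul_le_mul_of_nonneg_left hIb (by positivity)
  have e5 : (2 * τ)⁻¹ * (2 * τ * B + 4 * τ ^ 3 * ∫ x, ‖f x‖ ^ 2) = B + 2 * τ ^ 2 * ∫ x, ‖f x‖ ^ 2 := by
    field_simp
    ring
  have := hpt r hr0 hrτ
  linarith

/-- **Loudness on a short window after a restart**: the time-sliced weak formulation tested with the steady smooth
divergence-free force `f` bounds the drop of `(w(r), f)` below `(a, f)` by `r · K`,
`K ≥ ‖∇f‖_∞ B' + νM ‖Δf‖_∞ ½(1 + B')`, as long as the energy stays `≤ B'`. -/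
theorem loud_window {f : UnitAddTorus (Fin 3) → EuclideanSpace ℝ (Fin 3)}
    (hf : FunctionSpaces.Torus.IsSmooth f) (hdiv : FunctionSpaces.Torus.IsDivFree f) {ν νM : ℝ} (hν : 0 < ν) (hνM : ν ≤ νM)
    {a : UnitAddTorus (Fin 3) → EuclideanSpace ℝ (Fin 3)} {w : ℝ → UnitAddTorus (Fin 3) → EuclideanSpace ℝ (Fin 3)}
    (hw : IsGlobalLerayHopf ν (fun _ => f) a w) {B' τ : ℝ} (hτ0 : 0 < τ)
    (hyB : ∀ ρ, 0 ≤ ρ → ρ ≤ τ → ∫ x, ‖w ρ x‖ ^ 2 ≤ B')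
    {D KL K : ℝ} (hD0 : 0 ≤ D) (hD : ∀ x, ∑ i, ‖FunctionSpaces.Torus.partialDeriv i f x‖ ≤ D)
    (hKL0 : 0 ≤ KL) (hKL : ∀ x, ‖FunctionSpaces.Torus.laplacian f x‖ ≤ KL)
    (hK : D * B' + νM * (KL * (2⁻¹ * (1 + B'))) ≤ K)
    {r : ℝ} (hr0 : 0 < r) (hrτ : r ≤ τ) :
    (∫ x, ⟪a x, f x⟫) - r * K ≤ ∫ x, ⟪w r x, f x⟫ := by
  have hB'0 : 0 ≤ B' := (integral_nonneg fun x => sq_nonneg _).trans (hyB 0 le_rfl hτ0.le)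
  have hνM0 : 0 ≤ νM := hν.le.trans hνM
  have hK0 : 0 ≤ D * B' + νM * (KL * (2⁻¹ * (1 + B'))) := by positivity
  have hLH := hw τ hτ0
  have hid := hLH.integral_inner_eq_add_setIntegral hτ0 (aestronglyMeasurable_stLift_const hf _)
    (lintegral_enorm_sq_const_lt_top hf τ) hf hdiv ⟨hr0, hrτ⟩
  rw [hid]
  -- pointwise-in-time lower bound of the flux
  have hpt : ∀ s, 0 ≤ s → s ≤ τ → -(D * B' + νM * (KL * (2⁻¹ * (1 + B')))) ≤
      ∫ x, (⟪w s x, FunctionSpaces.Torus.convect (w s) f x⟫ + ν * ⟪w s x, FunctionSpaces.Torus.laplacian f x⟫ + ⟪f x, f x⟫) := by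
    intro s hs0 hsτ
    have hmem : MemLp (w s) 2 volume := hw.memLp_two hs0
    have i1 := integrable_inner_convect_self hmem hf
    have i2 : Integrable (fun x => ⟪w s x, FunctionSpaces.Torus.laplacian f x⟫) volume :=
      FunctionSpaces.Torus.integrable_inner_of_continuous (hmem.integrable one_le_two) hf.laplacian.continuous
    have i3 : Integrable (fun x => ⟪f x, f x⟫) volume :=
      FunctionSpaces.Torus.integrable_inner_of_continuous ((hf.memLp 2).integrable one_le_two) hf.continuous
    have i12 : Integrable (fun x => ⟪w s x, FunctionSpaces.Torus.convect (w s) f x⟫ +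
        ν * ⟪w s x, FunctionSpaces.Torus.laplacian f x⟫) volume := i1.add (i2.const_mul ν)
    rw [integral_add i12 i3, integral_add i1 (i2.const_mul ν), integral_const_mul]
    have b1 : |∫ x, ⟪w s x, FunctionSpaces.Torus.convect (w s) f x⟫| ≤ D * B' :=
      (abs_integral_inner_convect_self_le hmem hf hD).trans
        (mul_le_mul_of_nonneg_left (hyB s hs0 hsτ) hD0)
    have b2 : |ν * ∫ x, ⟪w s x, FunctionSpaces.Torus.laplacian f x⟫| ≤ νM * (KL * (2⁻¹ * (1 + B'))) := by
      rw [abs_mul, abs_of_pos hν]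
      refine mul_le_mul hνM ?_ (abs_nonneg _) hνM0
      refine (abs_integral_inner_le_of_norm_le (hmem.integrable one_le_two) hKL).trans ?_
      refine mul_le_mul_of_nonneg_left ((integral_norm_le_of_memLp_two hmem).trans ?_) hKL0
      gcongr
      exact hyB s hs0 hsτ
    have b3 : 0 ≤ ∫ x, ⟪f x, f x⟫ := integral_nonneg fun x => real_inner_self_nonneg
    have c1 := (abs_le.1 b1).1
    have c2 := (abs_le.1 b2).1
    linarith
  suffices h : -(r * K) ≤ ∫ s in Ioc 0 r,
      ∫ x, (⟪w s x, FunctionSpaces.Torus.convect (w s) f x⟫ + ν * ⟪w s x, FunctionSpaces.Torus.laplacian f x⟫ + ⟪f x, f x⟫) by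
    linarith
  have hrK : r * (D * B' + νM * (KL * (2⁻¹ * (1 + B')))) ≤ r * K := mul_le_mul_of_nonneg_left hK hr0.le
  by_cases hint : IntegrableOn (fun s => ∫ x, (⟪w s x, FunctionSpaces.Torus.convect (w s) f x⟫ +
      ν * ⟪w s x, FunctionSpaces.Torus.laplacian f x⟫ + ⟪f x, f x⟫)) (Ioc 0 r)
  · haveI : IsFiniteMeasure (volume.restrict (Ioc (0:ℝ) r)) :=
      ⟨by rw [Measure.restrict_apply_univ]; exact measure_Ioc_lt_top⟩
    have h1 : ∫ s in Ioc 0 r, (-(D * B' + νM * (KL * (2⁻¹ * (1 + B'))))) ≤ ∫ s in Ioc 0 r,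
        ∫ x, (⟪w s x, FunctionSpaces.Torus.convect (w s) f x⟫ + ν * ⟪w s x, FunctionSpaces.Torus.laplacian f x⟫ + ⟪f x, f x⟫) := by
      refine integral_mono_ae (integrable_const _) hint ?_
      filter_upwards [ae_restrict_mem measurableSet_Ioc] with s hs
      exact hpt s hs.1.le (hs.2.trans hrτ)
    rw [setIntegral_const, Real.volume_real_Ioc_of_le hr0.le, smul_eq_mul, sub_zero] at h1
    linarith
  · rw [integral_undef hint]
    have : 0 ≤ r * K := le_trans (mul_nonneg hr0.le hK0) hrK
    linarith

/-- **Loud-phase persistence** — verbatim `stub_loudPhasePersistence` / `DutyCycleBirthR1.LoudPhasePersistence`. -/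
theorem loudPhasePersistence : ∀ f : UnitAddTorus (Fin 3) → EuclideanSpace ℝ (Fin 3), Literature.Analysis.FunctionSpaces.Torus.IsSmooth f → Literature.Analysis.FunctionSpaces.Torus.IsDivFree f → Literature.Analysis.FunctionSpaces.Torus.HasZeroMean f → ∀ B β νmax : ℝ, 0 < β → ∃ B' τ : ℝ, 0 < τ ∧ ∀ ν : ℝ, 0 < ν → ν ≤ νmax → ∀ (u₀ : UnitAddTorus (Fin 3) → EuclideanSpace ℝ (Fin 3)) (u : ℝ → UnitAddTorus (Fin 3) → EuclideanSpace ℝ (Fin 3)), Literature.Analysis.FluidPDE.Torus.IsGlobalLerayHopf ν (fun _ => f) u₀ u → ∀ t : ℝ, 0 ≤ t → Literature.Analysis.FluidPDE.Torus.IsGlobalLerayHopf ν (fun _ => f) (u t) (fun τ => u (τ + t)) → (∫ x, ‖u t x‖ ^ 2) ≤ B → β ≤ ∫ x, inner ℝ (f x) (u t x) → ∀ s : ℝ, t ≤ s → s ≤ t + τ → (∫ x, ‖u s x‖ ^ 2) ≤ B' ∧ β / 2 ≤ ∫ x, inner ℝ (f x) (u s x) := by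
  intro f hfs hfd _hfm B β νmax hβ
  obtain ⟨D, hD0, hD⟩ := exists_sum_norm_partialDeriv_le hfs
  obtain ⟨KL, hKL0, hKL⟩ := exists_nonneg_forall_norm_le_of_continuous hfs.laplacian.continuous
  have hEf0 : 0 ≤ ∫ x, ‖f x‖ ^ 2 := integral_nonneg fun x => sq_nonneg _
  set B' : ℝ := 2 * max B 0 + 4 * ∫ x, ‖f x‖ ^ 2 with hB'def
  have hB'0 : 0 ≤ B' := by positivity
  set K : ℝ := D * B' + max νmax 0 * (KL * (2⁻¹ * (1 + B'))) with hKdef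
  have hK0 : 0 ≤ K := by positivity
  set τ : ℝ := min 1 (β / (2 * (K + 1))) with hτdef
  have hτ0 : 0 < τ := lt_min one_pos (by positivity)
  have hτ1 : τ ≤ 1 := min_le_left _ _
  have hτK : τ * K ≤ β / 2 := by
    have h1 : τ ≤ β / (2 * (K + 1)) := min_le_right _ _
    have h2 : τ * (2 * (K + 1)) ≤ β := (le_div_iff₀ (by positivity : (0:ℝ) < 2 * (K + 1))).1 h1
    nlinarith [hτ0.le, hK0]
  refine ⟨B', τ, hτ0, ?_⟩
  intro ν hν hνmax u₀ u _hu t _ht hw hB hβt s hts hst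
  have hνM : ν ≤ max νmax 0 := hνmax.trans (le_max_left _ _)
  have hB'B : 2 * B + 4 * τ ^ 2 * ∫ x, ‖f x‖ ^ 2 ≤ B' := by
    have h1 : τ ^ 2 ≤ 1 := by nlinarith
    have h2 : B ≤ max B 0 := le_max_left _ _
    nlinarith
  -- energy on the window
  have hy : ∀ ρ, 0 ≤ ρ → ρ ≤ τ → ∫ x, ‖u (ρ + t) x‖ ^ 2 ≤ B' := fun ρ hρ0 hρτ =>
    energy_window hfs hν hw hτ0 hB hB'B hρ0 hρτ
  obtain ⟨r, hr0, hrτ, rfl⟩ : ∃ r, 0 ≤ r ∧ r ≤ τ ∧ s = r + t := ⟨s - t, by linarith, by linarith, by ring⟩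
  refine ⟨hy r hr0 hrτ, ?_⟩
  have hcomm : ∀ v : UnitAddTorus (Fin 3) → EuclideanSpace ℝ (Fin 3),
      ∫ x, inner ℝ (f x) (v x) = ∫ x, inner ℝ (v x) (f x) :=
    fun v => integral_congr_ae (ae_of_all _ fun x => real_inner_comm _ _)
  rcases hr0.eq_or_lt with h0 | hrpos
  · rw [← h0, zero_add]
    linarith
  · have hL := loud_window hfs hfd hν hνM hw hτ0 hy hD0 hD hKL0 hKL (le_of_eq hKdef.symm) hrpos hrτ
    rw [hcomm (u t)] at hβt
    rw [hcomm (u (r + t))]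
    have : r * K ≤ β / 2 := by nlinarith [hτK, hrτ, hK0, hr0]
    linarith

/-! ### Registered-stub alias (skeleton of item 27340: `stub_loudPhasePersistence` by name + signature; the other proved stub,
`stub_densityFromSyndeticPhases`, is aliased in part 1 `DutyCycleDensityFromSyndeticPhases.lean`; open: `stub_syndeticUpgrade`) -/

/-- registered stub `stub_loudPhasePersistence` of crux `DutyCycle.ReturnsHaveDensity` — PROVED. -/
theorem stub_loudPhasePersistence : ∀ f : UnitAddTorus (Fin 3) → EuclideanSpace ℝ (Fin 3), Literature.Analysis.FunctionSpaces.Torus.IsSmooth f → Literature.Analysis.FunctionSpaces.Torus.IsDivFree f → Literature.Analysis.FunctionSpaces.Torus.HasZeroMean f → ∀ B β νmax : ℝ, 0 < β → ∃ B' τ : ℝ, 0 < τ ∧ ∀ ν : ℝ, 0 < ν → ν ≤ νmax → ∀ (u₀ : UnitAddTorus (Fin 3) → EuclideanSpace ℝ (Fin 3)) (u : ℝ → UnitAddTorus (Fin 3) → EuclideanSpace ℝ (Fin 3)), Literature.Analysis.FluidPDE.Torus.IsGlobalLerayHopf ν (fun _ => f) u₀ u → ∀ t : ℝ, 0 ≤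 t → Literature.Analysis.FluidPDE.Torus.IsGlobalLerayHopf ν (fun _ => f) (u t) (fun τ => u (τ + t)) → (∫ x, ‖u t x‖ ^ 2) ≤ B → β ≤ ∫ x, inner ℝ (f x) (u t x) → ∀ s : ℝ, t ≤ s → s ≤ t + τ → (∫ x, ‖u s x‖ ^ 2) ≤ B' ∧ β / 2 ≤ ∫ x, inner ℝ (f x) (u s x) :=
  loudPhasePersistence

/-! ### §3 The rung: Rβ1 restricted to syndetic families -/

/-- **BC5 RUNG (theorem): Rβ1 restricted to syndetic families.** Syndetic slim-loud restart-good returns with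
ν-free budgets carry a ν-free duty cycle `τ/(2(G+τ))` of the enlarged box `(B′, β/2)` — i.e. the currency hinge
`DutyCycle.DenseSlimLoudReturns` (tree decl of item 27342) holds for that family. -/
theorem returnsHaveDensity_rung
    (hS : ∃ f : UnitAddTorus (Fin 3) → EuclideanSpace ℝ (Fin 3), Literature.Analysis.FunctionSpaces.Torus.IsSmooth f ∧ Literature.Analysis.FunctionSpaces.Torus.IsDivFree f ∧ Literature.Analysis.FunctionSpaces.Torus.HasZeroMean f ∧ ∃ ν : ℕ → ℝ, (∀ j, 0 < ν j) ∧ Filter.Tendsto ν Filter.atTop (nhds 0) ∧ ∃ B β G : ℝ, 0 < β ∧ 0 < G ∧ ∀ j : ℕ, ∃ (u₀ : UnitAddTorus (Fin 3) → EuclideanSpace ℝ (Fin 3)) (u : ℝ → UnitAddTorus (Fin 3) → EuclideanSpace ℝ (Fin 3)), Literature.Analysis.FluidPDE.Torus.IsGlobalLerayHopf (ν j) (fun _ => f) u₀ u ∧ ∀ t₀ : ℝ, 0 ≤ t₀ → ∃ t : ℝ, t₀ ≤ t ∧ t ≤ t₀ + G ∧ Literature.Analysis.FluidPDE.Torus.IsGlobalLerayHopf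 (ν j) (fun _ => f) (u t) (fun τ => u (τ + t)) ∧ (∫ x, ‖u t x‖ ^ 2) ≤ B ∧ β ≤ ∫ x, inner ℝ (f x) (u t x)) :
    Summit.AnomalousDissipation.AnomalousDissipation.Theses.DutyCycle.DenseSlimLoudReturns := by
  obtain ⟨f, hfs, hfd, hfm, ν, hν, hν0, B, β, G, hβ, hG, hj⟩ := hS
  obtain ⟨νmax, hνmax⟩ := hν0.bddAbove_range
  have hνle : ∀ j, ν j ≤ νmax := fun j => hνmax ⟨j, rfl⟩
  obtain ⟨B', τ, hτ, hper⟩ := loudPhasePersistence f hfs hfd hfm B β νmax hβ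
  refine ⟨f, hfs, hfd, hfm, ν, hν, hν0, B', β / 2, τ / (2 * (G + τ)), by positivity, by positivity, fun j => ?_⟩
  obtain ⟨u₀, u, hLH, hret⟩ := hj j
  refine ⟨u₀, u, hLH, ?_⟩
  have hR : ∀ᵐ t : ℝ, 0 < t →
      Literature.Analysis.FluidPDE.Torus.IsGlobalLerayHopf (ν j) (fun _ => f) (u t) (fun τ => u (τ + t)) :=
    hLH.ae_isGlobalLerayHopf_translate hfs (hν j).le
  have hQ : ∀ t₀ : ℝ, 0 ≤ t₀ → ∃ t : ℝ, t₀ ≤ t ∧ t ≤ t₀ + G ∧ ∀ s : ℝ, t ≤ s → s ≤ t + τ →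
      (∫ x, ‖u s x‖ ^ 2) ≤ B' ∧ β / 2 ≤ ∫ x, inner ℝ (f x) (u s x) := by
    intro t₀ ht₀
    obtain ⟨t, h1, h2, hgood, hslim, hloud⟩ := hret t₀ ht₀
    exact ⟨t, h1, h2, fun s hs1 hs2 =>
      hper (ν j) (hν j) (hνle j) u₀ u hLH t (ht₀.trans h1) hgood hslim hloud s hs1 hs2⟩
  intro T₀
  obtain ⟨T, hT, hvol⟩ := densityFromSyndeticPhases
    (fun s => (∫ x, ‖u s x‖ ^ 2) ≤ B' ∧ β / 2 ≤ ∫ x, inner ℝ (f x) (u s x))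
    (fun t => Literature.Analysis.FluidPDE.Torus.IsGlobalLerayHopf (ν j) (fun _ => f) (u t) (fun τ => u (τ + t)))
    τ G hτ hG hR hQ T₀
  exact ⟨T, hT, hvol⟩

end Summit.AnomalousDissipation.AnomalousDissipation.Theorems.DutyCycle

end
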